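import Mathlib
import Summits.Ventures.PercRepro2.HCov
import Summits.Ventures.PercRepro2.GcInterior
import Summits.Ventures.PercRepro2.GcInteriorPos
import Summits.Ventures.PercRepro2.GcSkelReductionC
import Summits.Ventures.PercRepro2.GcBlockPush
import Summits.Ventures.PercRepro2.GcBlockConn
import Summits.Ventures.PercRepro2.GcTransportScaled
import Summits.Ventures.PercRepro2.GcBundlePush
import Summits.Ventures.PercRepro2.GcBundleConn

/-!
# The root bundle scales the covariance form: `Gc = c³ · Gc'` (blind cell PercRepro2, typer-1 g57)

A **root bundle** (`Bundle.IsBundle ends W a₁ a₂ v`, `GcBundleConn.lean`) — a mark-free vertex set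
`W` whose external terminals are the two roots and one further vertex `v` — is an exact REDUCTION
of the weighted calculus, the hat (`Hat.Gc_hat`, `W = {u}`) for an arbitrary `W`. It is a scaled
transport (`Scale.IsScaledTransport`, `GcTransportScaled.lean`): the bundle pushforward
(`Bundle.prob_bundle_pushforward`) and the bundle connectivity (`Bundle.conn_bundle_iff`) are
exactly its two hypotheses, so

* **`Gc_bundle`** — `Gc p ends = c³ · Gc (bundleWeights …) (bundleEnds …)`, with `c = (A + N)(B + N)
  / N` the scale of the three pattern masses `N, A, B` of the bundle;
* at interior weights `N > 0` (the all-closed configuration, `bundleN_pos_of_int`), so `c > 0`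
  (`bundleC_pos_of_int`) and the bundle weights are admissible (`isProbVec_bundleWeights_of_int`);
  **`HCov_of_bundle`** — (HCOV) on the bundle graph gives (HCOV) on `G`;
* **`nonLoopCard_bundleEnds_lt`** — the bundle graph has fewer non-loop edges as soon as three
  distinct non-loop edges touch `W`; **`HasBundle`** — the instances the reduction shrinks;
  **`HCov_of_hasBundle`** — the reduction step for the strong induction of the weighted residual
  (folded into the class of record in `GcSkelReductionBundle.lean`).

The weighted twin of the typed lane's root bundle (`RootBundlePart`, mine-2 g43). Standard axioms.
-/

namespace Summit.Ventures.PercRepro2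

open CovForm RECM SepPair WRed Block

namespace Bundle

/-! ## The scaled transport -/

section Transport

variable {V : Type*} {E : Type*} [Fintype E] [DecidableEq E] [DecidableEq V] {R : Type*} [Field R]

omit [DecidableEq V] in
/-- **The root bundle is a scaled transport**: the bundle map with the admissible sets
`BundleG₀` (no `a₁ ↔ a₂` inside `S`) / `BundleG` (not both pattern edges open), the constant
`bundleC`, on the vertices outside `W`. -/
theorem isScaledTransport_bundle {ends : E → Sym2 V} {W : Set V} {a₁ a₂ v : V}
    (hW : IsBundle ends W a₁ a₂ v) {S : Set E} [DecidablePred (· ∈ S)]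
    (hS : ∀ e, e ∈ S ↔ e ∈ touches ends W) {eA eB : E} (hA : eA ∈ S) (hB : eB ∈ S) (hAB : eA ≠ eB)
    (p : E → R)
    (hN : massAB p (BundleG₀ ends S a₁ a₂) (blockObs ends S a₁ v) (blockObs ends S a₂ v)
      false false ≠ 0)
    (hAN : massAB p (BundleG₀ ends S a₁ a₂) (blockObs ends S a₁ v) (blockObs ends S a₂ v)
      true false + massAB p (BundleG₀ ends S a₁ a₂) (blockObs ends S a₁ v) (blockObs ends S a₂ v)
      false false ≠ 0)
    (hBN : massAB p (BundleG₀ ends S a₁ a₂) (blockObs ends S a₁ v) (blockObs ends S a₂ v)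
      false true + massAB p (BundleG₀ ends S a₁ a₂) (blockObs ends S a₁ v) (blockObs ends S a₂ v)
      false false ≠ 0) :
    Scale.IsScaledTransport p
      (bundleWeights S eA eB
        (bundleQ1 p (BundleG₀ ends S a₁ a₂) (blockObs ends S a₁ v) (blockObs ends S a₂ v))
        (bundleQ2 p (BundleG₀ ends S a₁ a₂) (blockObs ends S a₁ v) (blockObs ends S a₂ v)) p)
      ends (bundleEnds ends S eA eB a₁ a₂ v)
      (bundleMap S eA eB (blockObs ends S a₁ v) (blockObs ends S a₂ v)) (BundleG₀ ends S a₁ a₂)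
      (BundleG eA eB)
      (bundleC p (BundleG₀ ends S a₁ a₂) (blockObs ends S a₁ v) (blockObs ends S a₂ v)) a₁ a₂
      {x | x ∉ W} where
  push Y := prob_bundle_pushforward p S hA hB hAB (dependsOn_blockObs ends S a₁ v)
    (dependsOn_blockObs ends S a₂ v) (dependsOn_bundleG₀ ends S a₁ a₂)
    (fun _ hω => not_both_of_mem_bundleG₀ ends S a₁ a₂ v hω) hN hAN hBN Y
  memG _ hc := mem_bundleG₀_of_not_conn ends S a₁ a₂ hc
  memG' ω hc := by
    by_contra hω
    exact hc (conn_roots_bundle_of_not_mem_bundleG ends S hAB a₁ a₂ v hω)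
  conn _ hω x hx z hz := conn_bundle_iff hW hS hA hB hAB hω hx hz
  mem₁ := hW.a₁_notMem
  mem₂ := hW.a₂_notMem

omit [DecidableEq V] in
/-- **The root bundle scales the covariance form**: `Gc p ends = c³ · Gc (bundleWeights …)
(bundleEnds …)` for marks `o, a₃, b` outside `W`. -/
theorem Gc_bundle [LinearOrder R] [IsStrictOrderedRing R] {ends : E → Sym2 V} {W : Set V}
    {a₁ a₂ v : V} (hW : IsBundle ends W a₁ a₂ v) {S : Set E} [DecidablePred (· ∈ S)]
    (hS : ∀ e, e ∈ S ↔ e ∈ touches ends W) {eA eB : E} (hA : eA ∈ S) (hB : eB ∈ S) (hAB : eA ≠ eB)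
    (p : E → R)
    (hN : massAB p (BundleG₀ ends S a₁ a₂) (blockObs ends S a₁ v) (blockObs ends S a₂ v)
      false false ≠ 0)
    (hAN : massAB p (BundleG₀ ends S a₁ a₂) (blockObs ends S a₁ v) (blockObs ends S a₂ v)
      true false + massAB p (BundleG₀ ends S a₁ a₂) (blockObs ends S a₁ v) (blockObs ends S a₂ v)
      false false ≠ 0)
    (hBN : massAB p (BundleG₀ ends S a₁ a₂) (blockObs ends S a₁ v) (blockObs ends S a₂ v)
      false true + massAB p (BundleG₀ ends S a₁ a₂) (blockObs ends S a₁ v) (blockObs ends S a₂ v)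
      false false ≠ 0) {o a₃ b : V} (ho : o ∉ W) (h3 : a₃ ∉ W) (hb : b ∉ W) :
    Gc p ends o a₁ a₂ a₃ b =
      bundleC p (BundleG₀ ends S a₁ a₂) (blockObs ends S a₁ v) (blockObs ends S a₂ v) ^ 3 *
        Gc (bundleWeights S eA eB
          (bundleQ1 p (BundleG₀ ends S a₁ a₂) (blockObs ends S a₁ v) (blockObs ends S a₂ v))
          (bundleQ2 p (BundleG₀ ends S a₁ a₂) (blockObs ends S a₁ v) (blockObs ends S a₂ v)) p)
          (bundleEnds ends S eA eB a₁ a₂ v) o a₁ a₂ a₃ b :=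
  Scale.Gc_scale (isScaledTransport_bundle hW hS hA hB hAB p hN hAN hBN) ho h3 hb

end Transport

/-! ## Interior weights: the masses, the scale and the admissibility -/

section Interior

variable {V : Type*} {E : Type*} [Fintype E] [DecidableEq E] {R : Type*} [Field R]
  [LinearOrder R] [IsStrictOrderedRing R]

omit [Fintype E] [DecidableEq E] in
/-- The all-closed configuration is admissible with the empty pattern. -/
lemma allClosed_mem_massEvent (ends : E → Sym2 V) (S : Set E) [DecidablePred (· ∈ S)]
    {a₁ a₂ v : V} (h12 : a₁ ≠ a₂) (hv1 : v ≠ a₁) (hv2 : v ≠ a₂) :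
    (fun _ => false : Config E) ∈ BundleG₀ ends S a₁ a₂ ∩
      {ω | blockObs ends S a₁ v ω = false ∧ blockObs ends S a₂ v ω = false} := by
  have hr : restrictTo S (fun _ => false : Config E) = fun _ => false := by
    funext e; simp [restrictTo]
  refine ⟨?_, ?_, ?_⟩
  · show ¬ Conn ends (restrictTo S fun _ => false) a₁ a₂
    rw [hr, conn_allClosed_iff]; exact h12
  · show blockObs ends S a₁ v (fun _ => false) = false
    simp only [blockObs, hr, conn_allClosed_iff, decide_eq_false_iff_not]
    exact hv1.symm
  · show blockObs ends S a₂ v (fun _ => false) = false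
    simp only [blockObs, hr, conn_allClosed_iff, decide_eq_false_iff_not]
    exact hv2.symm

/-- **At interior weights the empty-pattern mass is positive.** -/
lemma bundleN_pos_of_int {p : E → R} (hp : IsIntVec p) (ends : E → Sym2 V) (S : Set E)
    [DecidablePred (· ∈ S)] {a₁ a₂ v : V} (h12 : a₁ ≠ a₂) (hv1 : v ≠ a₁) (hv2 : v ≠ a₂) :
    0 < massAB p (BundleG₀ ends S a₁ a₂) (blockObs ends S a₁ v) (blockObs ends S a₂ v)
      false false :=
  prob_pos_of_int hp ⟨_, allClosed_mem_massEvent ends S h12 hv1 hv2⟩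

/-- The pattern masses are nonnegative. -/
lemma massAB_nonneg {p : E → R} (hp : IsProbVec p) (G₀ : Set (Config E))
    (α β : Config E → Bool) (a b : Bool) : 0 ≤ massAB p G₀ α β a b :=
  prob_nonneg hp _

/-- At interior weights the scale of the bundle is positive. -/
lemma bundleC_pos_of_int {p : E → R} (hp : IsIntVec p) (ends : E → Sym2 V) (S : Set E)
    [DecidablePred (· ∈ S)] {a₁ a₂ v : V} (h12 : a₁ ≠ a₂) (hv1 : v ≠ a₁) (hv2 : v ≠ a₂) :
    0 < bundleC p (BundleG₀ ends S a₁ a₂) (blockObs ends S a₁ v) (blockObs ends S a₂ v) := by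
  have hN := bundleN_pos_of_int hp ends S h12 hv1 hv2
  have hA := massAB_nonneg hp.isProbVec (BundleG₀ ends S a₁ a₂) (blockObs ends S a₁ v)
    (blockObs ends S a₂ v) true false
  have hB := massAB_nonneg hp.isProbVec (BundleG₀ ends S a₁ a₂) (blockObs ends S a₁ v)
    (blockObs ends S a₂ v) false true
  unfold bundleC
  exact div_pos (mul_pos (by linarith) (by linarith)) hN

omit [Fintype E] in
/-- The bundle weights are admissible when the two pattern weights are. -/
lemma isProbVec_bundleWeights {p : E → R} (hp : IsProbVec p) (S : Set E)
    [DecidablePred (· ∈ S)] (eA eB : E) {q₁ q₂ : R} (h1 : 0 ≤ q₁) (h1' : q₁ ≤ 1) (h2 : 0 ≤ q₂)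
    (h2' : q₂ ≤ 1) : IsProbVec (bundleWeights S eA eB q₁ q₂ p) := by
  refine ⟨fun e => ?_, fun e => ?_⟩
  · by_cases hA : e = eA
    · subst hA; simp [bundleWeights, h1]
    · by_cases hB : e = eB
      · subst hB; simp [bundleWeights, hA, h2]
      · by_cases heS : e ∈ S
        · simp [bundleWeights, hA, hB, heS]
        · simp [bundleWeights, hA, hB, heS, hp.nonneg e]
  · by_cases hA : e = eA
    · subst hA; simp [bundleWeights, h1']
    · by_cases hB : e = eB
      · subst hB; simp [bundleWeights, hA, h2']
      · by_cases heS : e ∈ S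
        · simp [bundleWeights, hA, hB, heS]
        · simp [bundleWeights, hA, hB, heS, hp.le_one e]

/-- **At interior weights the bundle weights are admissible.** -/
lemma isProbVec_bundleWeights_of_int {p : E → R} (hp : IsIntVec p) (ends : E → Sym2 V) (S : Set E)
    [DecidablePred (· ∈ S)] (eA eB : E) {a₁ a₂ v : V} (h12 : a₁ ≠ a₂) (hv1 : v ≠ a₁) (hv2 : v ≠ a₂) :
    IsProbVec (bundleWeights S eA eB
      (bundleQ1 p (BundleG₀ ends S a₁ a₂) (blockObs ends S a₁ v) (blockObs ends S a₂ v))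
      (bundleQ2 p (BundleG₀ ends S a₁ a₂) (blockObs ends S a₁ v) (blockObs ends S a₂ v)) p) := by
  have hN := bundleN_pos_of_int hp ends S h12 hv1 hv2
  have hA := massAB_nonneg hp.isProbVec (BundleG₀ ends S a₁ a₂) (blockObs ends S a₁ v)
    (blockObs ends S a₂ v) true false
  have hB := massAB_nonneg hp.isProbVec (BundleG₀ ends S a₁ a₂) (blockObs ends S a₁ v)
    (blockObs ends S a₂ v) false true
  refine isProbVec_bundleWeights hp.isProbVec S eA eB ?_ ?_ ?_ ?_
  · unfold bundleQ1; exact div_nonneg hA (by linarith)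
  · unfold bundleQ1; exact div_le_one_of_le₀ (by linarith) (by linarith)
  · unfold bundleQ2; exact div_nonneg hB (by linarith)
  · unfold bundleQ2; exact div_le_one_of_le₀ (by linarith) (by linarith)

end Interior

/-! ## The drop in the number of non-loop edges, the closure and the reduction step -/

section Step

variable {V : Type*} {E : Type*} [Fintype E] [DecidableEq E] [DecidableEq V]

omit [Fintype E] [DecidableEq V] in
/-- A non-loop edge of the bundle graph is `eA`, `eB` or an edge outside `S`, and it is a non-loop
edge of `ends` when `ends eA`, `ends eB` are. -/
lemma not_isDiag_of_bundleEnds {ends : E → Sym2 V} {S : Set E} [DecidablePred (· ∈ S)]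
    {eA eB : E} (hA : eA ∈ S) (hB : eB ∈ S) (hdA : ¬ (ends eA).IsDiag) (hdB : ¬ (ends eB).IsDiag)
    (a₁ a₂ v : V) {e : E} (h : ¬ (bundleEnds ends S eA eB a₁ a₂ v e).IsDiag) :
    ¬ (ends e).IsDiag ∧ (e = eA ∨ e = eB ∨ e ∉ S) := by
  by_cases h1 : e = eA
  · subst h1; exact ⟨hdA, Or.inl rfl⟩
  · by_cases h2 : e = eB
    · subst h2; exact ⟨hdB, Or.inr (Or.inl rfl)⟩
    · by_cases heS : e ∈ S
      · rw [bundleEnds_apply_of_mem ends S a₁ a₂ v h1 h2 heS, Sym2.mk_isDiag_iff] at h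
        exact absurd rfl h
      · rw [bundleEnds_apply_of_notMem ends S hA hB a₁ a₂ v heS] at h
        exact ⟨h, Or.inr (Or.inr heS)⟩

/-- **The bundle graph has fewer non-loop edges** when three distinct non-loop edges touch the
bundle (the third one becomes a loop). -/
lemma nonLoopCard_bundleEnds_lt {ends : E → Sym2 V} {S : Set E} [DecidablePred (· ∈ S)]
    {eA eB e₃ : E} (hA : eA ∈ S) (hB : eB ∈ S) (h3 : e₃ ∈ S) (hAB : eA ≠ eB) (hA3 : eA ≠ e₃)
    (hB3 : eB ≠ e₃) (hdA : ¬ (ends eA).IsDiag) (hdB : ¬ (ends eB).IsDiag)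
    (hd3 : ¬ (ends e₃).IsDiag) (a₁ a₂ v : V) :
    nonLoopCard (bundleEnds ends S eA eB a₁ a₂ v) < nonLoopCard ends := by
  refine nonLoopCard_lt_of_inj id
    (fun e he => (not_isDiag_of_bundleEnds hA hB hdA hdB a₁ a₂ v he).1) (fun _ _ _ _ h => h) hd3
    (fun e he h => ?_)
  have h' : e = e₃ := h
  rcases (not_isDiag_of_bundleEnds hA hB hdA hdB a₁ a₂ v he).2 with rfl | rfl | heS
  · exact hA3 h'
  · exact hB3 h'
  · exact heS (h' ▸ h3)

variable {R : Type*} [Field R] [LinearOrder R] [IsStrictOrderedRing R]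

omit [DecidableEq V] in
/-- **THE BUNDLE CLOSURE**: at interior weights, (HCOV) on the bundle graph under the bundle
weights gives (HCOV) on `G`. -/
theorem HCov_of_bundle {p : E → R} (hp : IsIntVec p) {ends : E → Sym2 V} {W : Set V} {a₁ a₂ v : V}
    (hW : IsBundle ends W a₁ a₂ v) {S : Set E} [DecidablePred (· ∈ S)]
    (hS : ∀ e, e ∈ S ↔ e ∈ touches ends W) {eA eB : E} (hA : eA ∈ S) (hB : eB ∈ S) (hAB : eA ≠ eB)
    (h12 : a₁ ≠ a₂) (hv1 : v ≠ a₁) (hv2 : v ≠ a₂) {o a₃ b : V} (ho : o ∉ W) (h3 : a₃ ∉ W)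
    (hb : b ∉ W)
    (H : HCov (bundleWeights S eA eB
        (bundleQ1 p (BundleG₀ ends S a₁ a₂) (blockObs ends S a₁ v) (blockObs ends S a₂ v))
        (bundleQ2 p (BundleG₀ ends S a₁ a₂) (blockObs ends S a₁ v) (blockObs ends S a₂ v)) p)
      (bundleEnds ends S eA eB a₁ a₂ v) o a₁ a₂ a₃ b) :
    HCov p ends o a₁ a₂ a₃ b := by
  have hN := bundleN_pos_of_int hp ends S h12 hv1 hv2
  have hA' := massAB_nonneg hp.isProbVec (BundleG₀ ends S a₁ a₂) (blockObs ends S a₁ v)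
    (blockObs ends S a₂ v) true false
  have hB' := massAB_nonneg hp.isProbVec (BundleG₀ ends S a₁ a₂) (blockObs ends S a₁ v)
    (blockObs ends S a₂ v) false true
  unfold HCov at H ⊢
  rw [Gc_bundle hW hS hA hB hAB p hN.ne' (by linarith) (by linarith) ho h3 hb]
  exact mul_nonneg (pow_nonneg (bundleC_pos_of_int hp ends S h12 hv1 hv2).le 3) H

/-- **A root bundle the reduction shrinks**: a mark-free root bundle with terminals `a₁, a₂, v`
(`v` not a root) touched by three distinct non-loop edges. -/
def HasBundle (ends : E → Sym2 V) (o a₁ a₂ a₃ b : V) : Prop :=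
  ∃ (W : Set V) (v : V), IsBundle ends W a₁ a₂ v ∧ (∀ y ∈ W, Unmarked o a₁ a₂ a₃ b y) ∧
    v ≠ a₁ ∧ v ≠ a₂ ∧ ∃ eA eB e₃, eA ≠ eB ∧ eA ≠ e₃ ∧ eB ≠ e₃ ∧ eA ∈ touches ends W ∧
      eB ∈ touches ends W ∧ e₃ ∈ touches ends W ∧ ¬ (ends eA).IsDiag ∧ ¬ (ends eB).IsDiag ∧
      ¬ (ends e₃).IsDiag

/-- **The bundle reduction step**: at interior weights, on an instance with a root bundle the
reduction shrinks, (HCOV) follows from (HCOV) on every admissible instance with fewer non-loop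
edges. -/
theorem HCov_of_hasBundle {p : E → R} (hp : IsIntVec p) {ends : E → Sym2 V} {o a₁ a₂ a₃ b : V}
    (h12 : a₁ ≠ a₂)
    (ih : ∀ ends' : E → Sym2 V, nonLoopCard ends' < nonLoopCard ends → ∀ p' : E → R,
      IsProbVec p' → HCov p' ends' o a₁ a₂ a₃ b)
    (h : HasBundle ends o a₁ a₂ a₃ b) : HCov p ends o a₁ a₂ a₃ b := by
  classical
  obtain ⟨W, v, hW, hU, hv1, hv2, eA, eB, e₃, hAB, hA3, hB3, hA, hB, h3, hdA, hdB, hd3⟩ := h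
  have hmark : ∀ x, ¬ Unmarked o a₁ a₂ a₃ b x → x ∉ W := fun x hx hxW => hx (hU x hxW)
  have ho : o ∉ W := hmark o fun h => h.1 rfl
  have ha3 : a₃ ∉ W := hmark a₃ fun h => h.2.2.2.1 rfl
  have hb : b ∉ W := hmark b fun h => h.2.2.2.2 rfl
  exact HCov_of_bundle hp hW (S := touches ends W) (fun _ => Iff.rfl) hA hB hAB h12 hv1 hv2 ho ha3
    hb (ih _ (nonLoopCard_bundleEnds_lt hA hB h3 hAB hA3 hB3 hdA hdB hd3 a₁ a₂ v) _
      (isProbVec_bundleWeights_of_int hp ends (touches ends W) eA eB h12 hv1 hv2))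

end Step

end Bundle

end Summit.Ventures.PercRepro2
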